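import Summits.HodgeConjecture.HodgeConjecture.Theorems.R90S6TorusFixedSpecialCount      -- ★ W8-i′ FILE 1 `natCard_fixedBy_special_add_eq_one_add_sum` (a₁ + a₀ = 1 + Σ s(x))
import Summits.HodgeConjecture.HodgeConjecture.Theorems.R90S6ResidualStarFixedPoints    -- ★ W8-i″ FILE 2 `natCard_fixedBy_star_eq_ncard_fixed_neighborSet_root` (s(x) = #fixed star of k_x)
import Summits.HodgeConjecture.HodgeConjecture.Theorems.R90S6ResidualStarFixedScalar    -- ★ 3a `ncard_fixed_neighborSet_root_of_residually_scalar` (k ≡ c ⇒ s = #star)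
import Summits.HodgeConjecture.HodgeConjecture.Theorems.R90S6ResidualStarFixedUnipotent -- ★ 3u = G1 rung 1a `ncard_fixed_neighborSet_root_eq_one_of_residually_unipotent` ((k − c)³ ≡ 0 ≢ k − c ⇒ s = 1)
import Literature.NumberTheory.Automorphic.UnitaryFixedCosetsStableLattices              -- ★ `unitaryInt_eq_glInt_subgroupOf`
import Mathlib.LinearAlgebra.Matrix.Charpoly.Coeff
import HarnessLib

/-!
# R90 · S6 «Ch. 14.1–14.5 stable trace formula» — LINE G1 «geometric fixed subtree», RUNG 1: THE UNIPOTENT DICHOTOMY FOR THE FIXED SPECIAL VERTICES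
# `a₁(γ) = 1 + (#star − 1)·ℓ₁(γ)` for a residually unipotent `γ` (`Theorems/R90S6TorusFixedSpecialCountUnipotent.lean`)

Cell `hodgecm-mathlib`, crux H413 (`stmt-HodgeConjecture-24833`), route of record `HCCMUnconditional`; programme R90-TF, section S6 (base `R90-C14`), seat R90-C14-p07 (g0);
S6 dealer R90-C14-plan (g2) RULING G1 = (α) (R90 bus 2026-09-05T00:23:35Z): line G1 «geometric fixed-subtree» (serves the cards S1 type (1), S2 type (2) and the displacement
counts E1.3.5.2.3), RUNG 1; statement = sheet `R90/R90-C14-typ1/g2/S6_G1_fixedsubtree_targets.v1.1` §3 (R1.1) VERBATIM.  Helper lane `--supports stmt-HodgeConjecture-24833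
--as helper`; THREE theorems (one public head + two charpoly lemmas); no definition, no instance, no notation, no named fact, no `sorry`; imports = ★ W8-i′ FILE 1 + ★ W8-i″
FILE 2 + ★ 3a + ★ 3u (rung 1a) + ★ `UnitaryFixedCosetsStableLattices` + Mathlib charpoly + HarnessLib (no Lines import).

THE MATHEMATICS [Kottwitz1988, §2; Serre1980Trees, I §6, II.1.1; Rogawski1990, §3.9, §4.9].  `K` a valued field with an unramified datum `hd : UnramifiedLocalConjDatum σ ϖ`,
`U = U(σ, J₀)(K)`, `K₀ = U ∩ GL₃(𝒪)` (stabiliser of the root `L₀`), `K₁ = U ∩ g₁GL₃(𝒪)g₁⁻¹` (stabiliser of the special neighbour `N₁`), `I = K₀ ⊓ K₁`; for `γ ∈ U` with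
finitely many fixed hyperspecial ∕ special vertices put `a₀ = #Fix_γ(U⧸K₀)`, `a₁ = #Fix_γ(U⧸K₁)`, and for each fixed hyperspecial `x` the local monodromy `k_x = r(x)⁻¹γr(x) ∈ K₀`
(`r` a section of `U → U⧸K₀`) with residual fixed-star value `s(x) = #Fix_{k_x}(K₀⧸I_{K₀})` = the number of `γ`-fixed special neighbours of `x`.  ★ FILE 1: `a₁ + a₀ = 1 + Σ_x s(x)`.
SUPPOSE `γ` IS RESIDUALLY UNIPOTENT UP TO A UNIT SCALAR `c` — its characteristic polynomial is `(X − c)³` modulo the maximal ideal (every elliptic torus element of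
type (2) normalised by its anisotropic eigenvalue, since `t₁ ≡ 1 mod π_EL`; type (1) ∕ (3) elements of positive depth).  Then EVERY `k_x` has the same characteristic
polynomial (conjugation), so `(k_x − c)³ ≡ 0` entrywise (Cayley–Hamilton over `𝒪`: `v_sub_smul_one_pow_three_apply_lt_one_of_charpoly`), and the residual value is
DICHOTOMOUS: `s(x) = S := #star(L₀)` if `k_x ≡ c·1 (mod 𝔪)` (★ 3a; `S = q_v³ + 1` at an inert place), and `s(x) = 1` otherwise — a non-identity unipotent isometry of the
residual split hermitian 3-space fixes EXACTLY ONE isotropic line (★ `exists_isotropic_fixed_of_isNilpotent`, ★ `exists_smul_of_isotropic_fixed`), hence exactly one special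
neighbour (★ 3u = rung 1a `ncard_fixed_neighborSet_root_eq_one_of_residually_unipotent`; the norm-one property of `c̄` is automatic there).  CONSEQUENTLY
**`a₁ = 1 + (S − 1) · ℓ₁`**, `ℓ₁ := #{x ∈ Fix_γ(U⧸K₀) : k_x ≡ c (mod 𝔪)}` = the number of LEVEL-ONE fixed hyperspecial vertices (`(γ − c)·x ⊆ ϖ·x`; equivalently the
hyperspecial vertices whose whole star is fixed).  For the type-(2) torus element of Flicker exponents `(N, M)` at an inert place this reads `a₁ = 1 + q_v³·ℓ₁` with
`ℓ₁` the `(N−1, M−1)`-shifted hyperspecial count (rung 2 of the line); e.g. `N = 1, 2, 3 < M`: `a₁ = q³+1, q⁴+q³+1, q⁷+q⁴+q³+1`.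
HONEST LABEL: a composition (★ FILE 1 ∘ ★ FILE 2 ∘ ★ 3a ∘ ★ 3u), unconditional in its own letters; count-neutral until rung 2 (closed form of `ℓ₁`) and the E1.3.5.2 assembly
consume it; proves no printed statement.  HC_CM is proved only modulo the 7 printed citations (2 remaining named inputs: hLiu418 =
stmt-HodgeConjecture-24832, h413 = stmt-HodgeConjecture-24833) until rung 0 closes.

## References
* [Kottwitz1988] R. E. Kottwitz, *Tamagawa numbers*, Ann. of Math. 127 (1988), §2 (fixed-point counts on buildings, Euler–Poincaré).
* [Serre1980Trees] J.-P. Serre, *Trees* (1980), Ch. I §6 (fixed subtrees), Ch. II §1.1.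
* [Rogawski1990] J. D. Rogawski, *Automorphic Representations of Unitary Groups in Three Variables*, Ann. of Math. Stud. 123 (1990), §3.9 p. 32 (unipotents of `U(3)`), §4.9 pp. 54–56.
-/
set_option autoImplicit false
-- the mandated namespace repeats the single-problem summit's segment (`HodgeConjecture.HodgeConjecture`)
set_option linter.dupNamespace false

noncomputable section

open MulAction Polynomial
open Literature.NumberTheory.Automorphic Literature.NumberTheory.Automorphic.HermitianLattice Literature.NumberTheory.Automorphic.UnitaryGroup
open Literature.NumberTheory.Automorphic.UnitaryLatticeTree
open scoped Matrix MatrixGroups WithZero Valued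

namespace Summit.HodgeConjecture.HodgeConjecture.R90.S6

variable {K : Type*} [Field K] [Valued K ℤᵐ⁰]

/-! ### §1 Residual nilpotency of `(k − c)³` from the characteristic polynomial (Cayley–Hamilton over `𝒪`) -/

/-- Powers of an entrywise-integral matrix are entrywise integral. [folklore] -/
theorem v_pow_apply_le_one_of_forall_v_le_one {N : ℕ} {k : Matrix (Fin N) (Fin N) K} (hk : ∀ i j, Valued.v (k i j) ≤ 1) (n : ℕ) (a b : Fin N) :
    Valued.v ((k ^ n) a b) ≤ 1 := by
  induction n generalizing a b with
  | zero =>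
    rw [pow_zero, Matrix.one_apply]
    split_ifs
    · rw [map_one]
    · rw [map_zero]; exact zero_le_one
  | succ n ih =>
    rw [pow_succ, Matrix.mul_apply]
    refine Valuation.map_sum_le _ fun j _ => ?_
    rw [map_mul]
    exact mul_le_one' (ih a j) (hk j b)

/-- **Residual nilpotency from the characteristic polynomial**: if the entries of `k ∈ M₃(K)` are integral and the coefficients of `χ_k − (X − c)³` lie in the maximal ideal,
then every entry of `(k − c·1)³` lies in the maximal ideal — Cayley–Hamilton `χ_k(k) = 0` gives `(k − c·1)³ = −(χ_k − (X − c)³)(k) = −Σ_i d_i·kⁱ` with `|d_i| < 1`, `|kⁱ| ≤ 1`.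
[folklore] -/
theorem v_sub_smul_one_pow_three_apply_lt_one_of_charpoly {k : Matrix (Fin 3) (Fin 3) K} (hk : ∀ i j, Valued.v (k i j) ≤ 1) {c : K}
    (hχ : ∀ i, Valued.v ((k.charpoly - (X - C c) ^ 3).coeff i) < 1) (a b : Fin 3) :
    Valued.v (((k - c • (1 : Matrix (Fin 3) (Fin 3) K)) ^ 3) a b) < 1 := by
  have h1 : (k - c • (1 : Matrix (Fin 3) (Fin 3) K)) ^ 3 = aeval k ((X - C c) ^ 3) := by
    rw [map_pow, map_sub, aeval_X, aeval_C, Algebra.algebraMap_eq_smul_one]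
  have h2 : aeval k ((X - C c) ^ 3) = -aeval k (k.charpoly - (X - C c) ^ 3) := by
    rw [map_sub, Matrix.aeval_self_charpoly, zero_sub, neg_neg]
  rw [h1, h2, aeval_eq_sum_range, Matrix.neg_apply, Valuation.map_neg, Matrix.sum_apply]
  refine Valuation.map_sum_lt _ one_ne_zero fun i _ => ?_
  rw [Matrix.smul_apply, smul_eq_mul, map_mul]
  calc Valued.v ((k.charpoly - (X - C c) ^ 3).coeff i) * Valued.v ((k ^ i) a b)
      ≤ Valued.v ((k.charpoly - (X - C c) ^ 3).coeff i) * 1 := mul_le_mul_right (v_pow_apply_le_one_of_forall_v_le_one hk i a b) _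
    _ < 1 := by rw [mul_one]; exact hχ i

/-! ### §2 The unipotent dichotomy: `a₁ = 1 + (#star − 1)·ℓ₁` -/

set_option synthInstance.maxHeartbeats 400000 in
set_option maxHeartbeats 1600000 in
-- the iterated subgroup-quotient carriers `↥K₀ ⧸ I_{K₀}` of ★ FILE 1 are slow to elaborate at `U(Φ₃)` (same budget as ★ FILE 1)
/-- **G1 RUNG 1 — THE UNIPOTENT DICHOTOMY FOR THE FIXED SPECIAL VERTICES.**  In the letters of ★ W8-i′ FILE 1 (`K₀ = (glInt 3 K).subgroupOf U`, `K₁` its `g₁ = diag(1,1,ϖ)`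
conjugate, `r` a section of `U → U⧸K₀`, the same finiteness binders): if `γ ∈ U(σ, J₀)(K)` is RESIDUALLY UNIPOTENT up to the unit scalar `c` — the coefficients of
`χ_γ − (X − c)³` lie in the maximal ideal (`hχ`) — then
`#Fix_γ(U⧸K₁) + ℓ₁ = 1 + #star(L₀) · ℓ₁`, `ℓ₁ := #{x ∈ Fix_γ(U⧸K₀) : r(x)⁻¹γr(x) ≡ c·1 (mod 𝔪)}` — i.e.
the number of fixed SPECIAL vertices is `a₁ = 1 + (S − 1)·ℓ₁` (stated additively, no ℕ-subtraction) with `S` the valency of a hyperspecial vertex (`q_v³ + 1` at an inert place) and `ℓ₁` the number of fixed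
hyperspecial vertices of LEVEL ONE (local monodromy residually scalar ⟺ `(γ − c)·x ⊆ ϖ·x` ⟺ the whole star of `x` is fixed).  ★ FILE 1 gives `a₁ + a₀ = 1 + Σ_x s(x)`;
`s(x) = S` at level-one `x` (★ FILE 2 + ★ 3a) and `s(x) = 1` elsewhere (`(k_x − c)³ ≡ 0` by §1 and conjugation invariance of `χ`, then ★ 3u «residually unipotent,
not residually scalar ↦ exactly one fixed special neighbour»).
[cite: Kottwitz1988, §2] [cite: Serre1980Trees, I §6, II.1.1] [cite: Rogawski1990, §3.9 p. 32; §4.9 pp. 54–56] -/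
theorem natCard_fixedBy_special_eq_one_add_mul_of_residually_unipotent [ValuativeRel K] [(Valued.v : Valuation K ℤᵐ⁰).Compatible]
    {σ : K →+* K} {ϖ : K} (hd : UnramifiedLocalConjDatum σ ϖ)
    (g₁ : GL (Fin 3) K) (hg₁ : (g₁ : Matrix (Fin 3) (Fin 3) K) = Matrix.diagonal ![(1 : K), 1, ϖ])
    (γ : ↥(unitaryGroupOfForm σ ((StdForm.antidiagonal 3).over K)))
    [Fintype (fixedBy (↥(unitaryGroupOfForm σ ((StdForm.antidiagonal 3).over K)) ⧸
      (glInt 3 K).subgroupOf (unitaryGroupOfForm σ ((StdForm.antidiagonal 3).over K))) γ)]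
    (hK₁fin : (fixedBy (↥(unitaryGroupOfForm σ ((StdForm.antidiagonal 3).over K)) ⧸
      ((glInt 3 K).map (MulAut.conj g₁).toMonoidHom).subgroupOf (unitaryGroupOfForm σ ((StdForm.antidiagonal 3).over K))) γ).Finite)
    (horb : (Set.range fun n : ℕ => ((γ ^ n : ↥(unitaryGroupOfForm σ ((StdForm.antidiagonal 3).over K))) :
      ↥(unitaryGroupOfForm σ ((StdForm.antidiagonal 3).over K)) ⧸ (glInt 3 K).subgroupOf (unitaryGroupOfForm σ ((StdForm.antidiagonal 3).over K)))).Finite)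
    (r : ↥(unitaryGroupOfForm σ ((StdForm.antidiagonal 3).over K)) ⧸ (glInt 3 K).subgroupOf (unitaryGroupOfForm σ ((StdForm.antidiagonal 3).over K)) →
      ↥(unitaryGroupOfForm σ ((StdForm.antidiagonal 3).over K)))
    (hr : Function.RightInverse r QuotientGroup.mk)
    [∀ x : fixedBy (↥(unitaryGroupOfForm σ ((StdForm.antidiagonal 3).over K)) ⧸
        (glInt 3 K).subgroupOf (unitaryGroupOfForm σ ((StdForm.antidiagonal 3).over K))) γ,
      Finite (fixedBy (↥((glInt 3 K).subgroupOf (unitaryGroupOfForm σ ((StdForm.antidiagonal 3).over K))) ⧸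
        (((glInt 3 K).subgroupOf (unitaryGroupOfForm σ ((StdForm.antidiagonal 3).over K)) ⊓
          ((glInt 3 K).map (MulAut.conj g₁).toMonoidHom).subgroupOf (unitaryGroupOfForm σ ((StdForm.antidiagonal 3).over K))).subgroupOf
          ((glInt 3 K).subgroupOf (unitaryGroupOfForm σ ((StdForm.antidiagonal 3).over K)))))
        (⟨(r x.1)⁻¹ * γ * r x.1, inv_mul_mul_mem_of_smul_eq r hr γ x.2⟩ :
          ↥((glInt 3 K).subgroupOf (unitaryGroupOfForm σ ((StdForm.antidiagonal 3).over K)))))]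
    {c : K} (hc : Valued.v c = 1)
    (hχ : ∀ i, Valued.v (((((γ : ↥(unitaryGroupOfForm σ ((StdForm.antidiagonal 3).over K))) : GL (Fin 3) K) : Matrix (Fin 3) (Fin 3) K).charpoly -
      (X - C c) ^ 3).coeff i) < 1) :
    Nat.card (fixedBy (↥(unitaryGroupOfForm σ ((StdForm.antidiagonal 3).over K)) ⧸
        ((glInt 3 K).map (MulAut.conj g₁).toMonoidHom).subgroupOf (unitaryGroupOfForm σ ((StdForm.antidiagonal 3).over K))) γ) +
      Nat.card {x : fixedBy (↥(unitaryGroupOfForm σ ((StdForm.antidiagonal 3).over K)) ⧸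
            (glInt 3 K).subgroupOf (unitaryGroupOfForm σ ((StdForm.antidiagonal 3).over K))) γ //
          ∀ i j, Valued.v (((((r x.1)⁻¹ * γ * r x.1 : ↥(unitaryGroupOfForm σ ((StdForm.antidiagonal 3).over K))) : GL (Fin 3) K) :
            Matrix (Fin 3) (Fin 3) K) i j - c * (1 : Matrix (Fin 3) (Fin 3) K) i j) < 1} =
      1 + ((latticeGraph σ ϖ ((StdForm.antidiagonal 3).over K)).neighborSet ⟨stdLattice K 3, 0, isSelfDualLattice_stdLattice_three hd⟩).ncard *
        Nat.card {x : fixedBy (↥(unitaryGroupOfForm σ ((StdForm.antidiagonal 3).over K)) ⧸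
            (glInt 3 K).subgroupOf (unitaryGroupOfForm σ ((StdForm.antidiagonal 3).over K))) γ //
          ∀ i j, Valued.v (((((r x.1)⁻¹ * γ * r x.1 : ↥(unitaryGroupOfForm σ ((StdForm.antidiagonal 3).over K))) : GL (Fin 3) K) :
            Matrix (Fin 3) (Fin 3) K) i j - c * (1 : Matrix (Fin 3) (Fin 3) K) i j) < 1} := by
  classical
  -- abbreviations
  set S : ℕ := ((latticeGraph σ ϖ ((StdForm.antidiagonal 3).over K)).neighborSet ⟨stdLattice K 3, 0, isSelfDualLattice_stdLattice_three hd⟩).ncard with hS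
  -- ★ FILE 1: `a₁ + a₀ = 1 + Σ_x s(x)`
  have h1 := natCard_fixedBy_special_add_eq_one_add_sum hd g₁ hg₁ γ hK₁fin horb r hr
  -- the local monodromies are integral, with characteristic polynomial `χ_γ`
  have hkK₀ : ∀ x : fixedBy (↥(unitaryGroupOfForm σ ((StdForm.antidiagonal 3).over K)) ⧸
      (glInt 3 K).subgroupOf (unitaryGroupOfForm σ ((StdForm.antidiagonal 3).over K))) γ,
      ((r x.1)⁻¹ * γ * r x.1 : ↥(unitaryGroupOfForm σ ((StdForm.antidiagonal 3).over K))) ∈ unitaryInt σ ((StdForm.antidiagonal 3).over K) := by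
    intro x
    rw [unitaryInt_eq_glInt_subgroupOf]
    exact inv_mul_mul_mem_of_smul_eq r hr γ x.2
  have hkint : ∀ x : fixedBy (↥(unitaryGroupOfForm σ ((StdForm.antidiagonal 3).over K)) ⧸
      (glInt 3 K).subgroupOf (unitaryGroupOfForm σ ((StdForm.antidiagonal 3).over K))) γ,
      ∀ i j, Valued.v (((((r x.1)⁻¹ * γ * r x.1 : ↥(unitaryGroupOfForm σ ((StdForm.antidiagonal 3).over K))) : GL (Fin 3) K) :
        Matrix (Fin 3) (Fin 3) K) i j) ≤ 1 := fun x => (mem_unitaryInt_iff.1 (hkK₀ x)).1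
  have hχk : ∀ x : fixedBy (↥(unitaryGroupOfForm σ ((StdForm.antidiagonal 3).over K)) ⧸
      (glInt 3 K).subgroupOf (unitaryGroupOfForm σ ((StdForm.antidiagonal 3).over K))) γ,
      ((((r x.1)⁻¹ * γ * r x.1 : ↥(unitaryGroupOfForm σ ((StdForm.antidiagonal 3).over K))) : GL (Fin 3) K) : Matrix (Fin 3) (Fin 3) K).charpoly =
        (((γ : ↥(unitaryGroupOfForm σ ((StdForm.antidiagonal 3).over K))) : GL (Fin 3) K) : Matrix (Fin 3) (Fin 3) K).charpoly := by
    intro x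
    rw [Subgroup.coe_mul, Subgroup.coe_mul, Subgroup.coe_inv, Units.val_mul, Units.val_mul, Matrix.coe_units_inv]
    exact Matrix.charpoly_units_conj' _ _
  -- the dichotomy `s(x) ∈ {S, 1}`
  have hsx : ∀ x : fixedBy (↥(unitaryGroupOfForm σ ((StdForm.antidiagonal 3).over K)) ⧸
      (glInt 3 K).subgroupOf (unitaryGroupOfForm σ ((StdForm.antidiagonal 3).over K))) γ,
      Nat.card (fixedBy (↥((glInt 3 K).subgroupOf (unitaryGroupOfForm σ ((StdForm.antidiagonal 3).over K))) ⧸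
        (((glInt 3 K).subgroupOf (unitaryGroupOfForm σ ((StdForm.antidiagonal 3).over K)) ⊓
          ((glInt 3 K).map (MulAut.conj g₁).toMonoidHom).subgroupOf (unitaryGroupOfForm σ ((StdForm.antidiagonal 3).over K))).subgroupOf
          ((glInt 3 K).subgroupOf (unitaryGroupOfForm σ ((StdForm.antidiagonal 3).over K)))))
        (⟨(r x.1)⁻¹ * γ * r x.1, inv_mul_mul_mem_of_smul_eq r hr γ x.2⟩ :
          ↥((glInt 3 K).subgroupOf (unitaryGroupOfForm σ ((StdForm.antidiagonal 3).over K))))) =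
      if ∀ i j, Valued.v (((((r x.1)⁻¹ * γ * r x.1 : ↥(unitaryGroupOfForm σ ((StdForm.antidiagonal 3).over K))) : GL (Fin 3) K) :
            Matrix (Fin 3) (Fin 3) K) i j - c * (1 : Matrix (Fin 3) (Fin 3) K) i j) < 1 then S else 1 := by
    intro x
    rw [natCard_fixedBy_star_eq_ncard_fixed_neighborSet_root hd g₁ hg₁ _ (inv_mul_mul_mem_of_smul_eq r hr γ x.2)]
    split_ifs with hsc
    · exact ncard_fixed_neighborSet_root_of_residually_scalar hd _ (hkK₀ x) hc hsc
    · refine ncard_fixed_neighborSet_root_eq_one_of_residually_unipotent hd _ (hkK₀ x) hc (fun i j => ?_) ?_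
      · exact v_sub_smul_one_pow_three_apply_lt_one_of_charpoly (hkint x) (fun i => by rw [hχk x]; exact hχ i) i j
      · push Not at hsc
        obtain ⟨i, j, hij⟩ := hsc
        refine ⟨i, j, le_antisymm ?_ hij⟩
        refine (Valuation.map_sub _ _ _).trans (max_le (hkint x i j) ?_)
        rw [map_mul, hc, one_mul, Matrix.one_apply]
        split_ifs
        · rw [map_one]
        · rw [map_zero]; exact zero_le_one
  -- assemble: `Σ_x s(x) = S·ℓ₁ + (a₀ − ℓ₁)`
  rw [Finset.sum_congr rfl fun x _ => hsx x, Finset.sum_ite, Finset.sum_const, Finset.sum_const, smul_eq_mul, smul_eq_mul, mul_one] at h1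
  have hcard := Finset.card_filter_add_card_filter_not
    (s := (Finset.univ : Finset (fixedBy (↥(unitaryGroupOfForm σ ((StdForm.antidiagonal 3).over K)) ⧸
      (glInt 3 K).subgroupOf (unitaryGroupOfForm σ ((StdForm.antidiagonal 3).over K))) γ)))
    (fun x => ∀ i j, Valued.v (((((r x.1)⁻¹ * γ * r x.1 : ↥(unitaryGroupOfForm σ ((StdForm.antidiagonal 3).over K))) : GL (Fin 3) K) :
      Matrix (Fin 3) (Fin 3) K) i j - c * (1 : Matrix (Fin 3) (Fin 3) K) i j) < 1)
  rw [Finset.card_univ, ← Nat.card_eq_fintype_card] at hcard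
  rw [Nat.card_eq_fintype_card (α := {x : fixedBy (↥(unitaryGroupOfForm σ ((StdForm.antidiagonal 3).over K)) ⧸
      (glInt 3 K).subgroupOf (unitaryGroupOfForm σ ((StdForm.antidiagonal 3).over K))) γ // _}), Fintype.card_subtype]
  linarith [hcard, h1]

end Summit.HodgeConjecture.HodgeConjecture.R90.S6

end
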